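import Summits.QuantumFields.YangMills.Theorems.FluctuationComparisonRegPrIntLS2BetaCentralFaceDiscrepancyDock
import Summits.QuantumFields.YangMills.Theorems.FluctuationComparisonRegPrIntLS2BetaLiftLadderFaceRow
import Literature.MathematicalPhysics.QuantumFieldTheory.Balaban1983to89.BlockAveragingPlaquetteBound
import HarnessLib

/-!
# S2β · c₃ — TWO OF THE FOUR FACE LETTERS DISCHARGED BY NAME FOR THE CELL's AVERAGING `ℰp = exp[mean log]`: the absolute correction factor
# (`aκ := 6·((((d+2)L)²∕4)·a)` from lit ✓`dist1_corr_le` under `PlaqSmall a`) and the relative lift at the central bond (`mR := (11∕10)·L⁻¹·m` from the arc profile at the parent bond)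

Cell `ym3-torus` (YM ladder rung R3 = continuum `SU(2)` Yang–Mills on the three-torus at fixed lattice data — a RUNG: NOT d = 4, NOT infinite volume,
NOT a mass gap, NOT Clay).  Width seat «width 20» `ym3-torus-px20` (gen 24), FREE px helper on crux `stmt-QuantumFields-20520`
(`…Theses.UnitScaleTilt.FluctuationComparisonRegPrIntL`), LINE g18-1 S2β, the (ST) sup chain; c₃ ASSEMBLER (ARCHITECT RULINGS px17 g22 19:24:49Z (i), 19:37:59Z (1)).
THE CHAIN SO FAR: per-`B` one-profile row ✓p833084 (px5) ⟸ `hface` ⟸ Q11i∕Q11j `hface_of_central`∕`hface_of_letters` (px5) ⟸ ✓p834378 `central_hC_of_letters` (px20, generic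
small-loop average `ℰ`) ⟸ four letters {`ρκ`, `aκ`, `mR`, `ρ̃`}.  THIS FILE specialises to the cell's averaging `ℰp = exp[mean log]` on `SU(2)` (lit `T3UnitLawDensityEML.ℰp`,
the tower's `blockAvg ℰp`) and DISCHARGES two of them BY NAME: `aκ` — lit ✓`BlockAveragingPlaquetteBound.dist1_corr_le` ([Balaban1985Averaging] (19)–(20), (26)–(27): the
(0.4) loop variables are within `(((d+2)L)²∕4)·a` of `1` under `PlaqSmall a`, and `exp[mean log]` is within `6·` that of `1`) gives `dist1 (corr ℰp W₁ c) ≤ 6·((((d+2)L)²∕4)·a)`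
from the small-field class `PlaqSmall a W₁` of the stage field (gauge-equivalent to `Ū^jU₁`'s, lit ✓`plaqSmall_gaugeAct_iff'`) and the threshold `(((d+2)L)²∕4)·a < δ_{SU(2)}`;
`mR` — the central bond `b₀(c_b)`'s ONLY hat feeder is the parent bond `c_b = ⟨blockOf b₋, dir b⟩` (✓`feeder_b0` from ✓`hatW_line_of_ne`), so ✓p832421
`norm_logVec_liftChord_le_eleven_tenths` with the arc profile AT `c_b` (`σ ≤ 1∕4`) and the parent relative chord `≤ m` gives `dist1 R(b₀) ≤ arc R(b₀) ≤ (11∕10)·L⁻¹·m` (✓`…GeodesicJensenLift.dist1_le_norm_logVec`).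
RESULT: `sC := ρκ + 2·(6·((((d+2)L)²∕4)·a))·((((L−1)∕2 + 1)·((11∕10)·(L⁻¹·m)))` — ONE analytic letter `ρκ` (the RELATIVE correction factor, (O3-LOC)'s object, c₁'s curl
currency) + the classes `a` (stage plaquettes — (D-stage)∕(K5) side), `σ` (arc profile), `m` (parent read max — `E′` currency; `a × m` is FEEDBACK).
`--kind proof --supports stmt-QuantumFields-20520 --as helper`, count-neutral, DEFINITION-FREE (0 `def`, 0 `instance`, 0 `notation`, 0 `sorry`, default heartbeats);
`SU(2)`, generic `P : Params`, levels `j∕j+1`, standing range, `2 ≤ L`.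

WHAT IS PROVED (sorry-free).
* `feeder_b0 : Q c → ∀ e, wt (b0 c) e ≠ 0 → Q e` (the central bond's only feeder is `c`).
* ★★★`central_hC_of_two_letters` — px5's `hC` binder text VERBATIM at `av := blockAvg ℰp`, from `hκrel` (`ρκ`), `hplaq : PlaqSmall a W₁` + `hthr`, `hσS`∕`hσS'` (arc profile at
  `c_b`), `hmS` (parent relative chord at `c_b` `≤ m`), `0 ≤ a`, `0 ≤ m`, `2 ≤ L`, `σ ≤ 1∕4`.

INHABITATION (★★OWNER RULING №100): LAW-FREE — `PlaqSmall a` of the stage field is the small-field axiom's class ((K5)∕(D-stage)); `σ`, `m` are the arc profile ∕ read maxima the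
rows already carry; `ρκ` is the one letter left to the c₁ budget holders (px16∕px13; (O3-LOC) ✓p831296 §3 is its linearisation).

HONEST SCOPE.  Bookkeeping over landed letters by name; nothing of Bałaban's renormalisation-group analysis is asserted or proved ([Balaban1987RG1] (0.4) p.253; [Balaban1985Averaging]
(19)–(20) p.21, (26)–(27) p.22; [Balaban1985RegularSpaces] (1.19) p.79, (1.29) p.81); `ρκ`∕`ρ̃`, the arc profile, (BKG), (TOP-LAD′), the budgets (SCT′), (ST″)∕(ST′)∕(ST), LOC″∕LOC are
HYPOTHESES ∕ other files; GAP♯∘ (`stub_uniformFibreGapOrbit`, registry 3732b7df UNTOUCHED), the five registered stubs (0∕5), S2β, 20520, 19936, 19200, `YM3TorusSU2` are NOT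
proved; no registered stub is closed; rung R3 — NOT d = 4, NOT infinite volume, NOT a mass gap, NOT Clay; the Yang–Mills mass gap is NOT proved.
-/

set_option autoImplicit false

namespace Summit.QuantumFields.YangMills.Theorems.FluctuationComparisonRegPrIntLS2BetaCentralFaceLetters

open Literature.MathematicalPhysics.QuantumLattice (su2Quat)
open Literature.MathematicalPhysics.QuantumFieldTheory.Balaban1983to89
open T4Continuum BlockAveraging AveragingRT B10Eq47AxialChi
open B10Eq27TorusAxialLog (rel axialT transl)
open T4CubeChartGnomonic (SU2)
open T4HaarSU2ExpChart (expPoint)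
open T4ExpWindowSmallField (logVec)
open Summit.QuantumFields.YangMills.Theorems.FluctuationComparisonRegPrIntLS2BetaGeodesicJensenLift (dist1_le_norm_logVec)
open B12SmallFieldDomain259 (b0)
open ExpMeanLog (expMeanLogSU deltaSU)
open T3UnitLawDensityEML (ℰp)
open BlockAveragingPlaquetteBound (dist1_corr_le)
open Summit.QuantumFields.YangMills.Theorems.FluctuationComparisonRegPrIntLS2BetaWhitneyHatWeights (hatW_line_of_ne)
open Summit.QuantumFields.YangMills.Theorems.FluctuationComparisonRegPrIntLS2BetaLiftLadderFaceRow (norm_logVec_liftChord_le_eleven_tenths)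
open Summit.QuantumFields.YangMills.Theorems.FluctuationComparisonRegPrIntLS2BetaCentralFaceDiscrepancyDock (centralBond_eq_b0 central_hC_of_letters)

variable {P : Params}

/-- The hat lift's only feeder of the central bond `b₀(c)` is `c` itself (✓`hatW_line_of_ne`): a bound at `c` is a bound on every feeder. [cite: Balaban1985RegularSpaces, (1.29) p.81] -/
theorem feeder_b0 {j : ℕ} (hj : j + 1 ≤ P.m + P.K) (w : PBond P j → PBond P (j + 1) → ℝ)
    (hw : ∀ b e, w b e = if e.dir = b.dir ∧ (b.src b.dir - emb e.src b.dir).val < P.L then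
      ∏ ν ∈ Finset.univ.erase b.dir, max 0 (1 - ((rel (emb e.src) b.src ν).natAbs : ℝ) / P.L) else 0)
    (c : PBond P (j + 1)) {Q : PBond P (j + 1) → Prop} (hQ : Q c) : ∀ e, w (b0 c) e ≠ 0 → Q e := by
  intro e he
  by_cases hec : e = c
  · rw [hec]; exact hQ
  · exact absurd (hatW_line_of_ne hj w hw c (k := (P.L - 1) / 2) (by have := P.L_pos; omega) hec) he

/-- ★★★ **THE CENTRAL FACE LETTER `hC` FROM TWO LETTERS + TWO CLASSES, FOR THE CELL's AVERAGING `ℰp`.**  In ✓p834378 `central_hC_of_letters` (generic `ℰ`)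
take `ℰ := ℰp = exp[mean log]` on `SU(2)`: the ABSOLUTE correction-factor letter `hκabs` is DISCHARGED by lit ✓`BlockAveragingPlaquetteBound.dist1_corr_le`
(`dist1 (corr ℰp W₁ c) ≤ 6·((((d+2)L)²∕4)·a)` under `PlaqSmall a W₁` and `(((d+2)L)²∕4)·a < δ_{SU(2)}` — the small-field class of the stage field, gauge-equivalent
to that of `Ū^jU₁` by lit ✓`plaqSmall_gaugeAct_iff'`), and the relative-lift letter `hR` is DISCHARGED by the arc profile at the PARENT bond `c_b = ⟨blockOf b₋, dir b⟩`
alone (the central bond's only feeder is `c_b`, ✓`feeder_b0`; ✓p832421 `norm_logVec_liftChord_le_eleven_tenths`; `|x − 1| ≤ arc x`): so px5's Q11i∕Q11j `hC` holds with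
**`sC := ρκ + 2·(6·((((d+2)L)²∕4)·a))·((((L−1)∕2 + 1)·((11∕10)·(L⁻¹·m)))`** from ONE analytic letter `ρκ` (the RELATIVE correction factor — (O3-LOC)'s object,
c₁'s curl currency) plus the classes `a` (stage-field plaquettes), `σ ≤ 1∕4` (arc profile at `c_b`) and `m` (the parent relative chord at `c_b` — `E′` currency; the
product `a × m` is FEEDBACK). [cite: Balaban1987RG1, (0.4) p.253; Balaban1985Averaging, (19)-(20) p.21, (26)-(27) p.22; Balaban1985RegularSpaces, (1.19) p.79, (1.29) p.81] -/
theorem central_hC_of_two_letters {j : ℕ} (hj : j + 1 ≤ P.m + P.K)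
    (wt : (i : ℕ) → PBond P i → PBond P (i + 1) → ℝ) (lift : (i : ℕ) → GaugeField P (i + 1) SU2 → GaugeField P i SU2)
    (g g₀ : (i : ℕ) → Site P i → SU2) (U U₁ : GaugeField P 0 SU2)
    (hwt : ∀ b e, wt j b e = if e.dir = b.dir ∧ (b.src b.dir - emb e.src b.dir).val < P.L then
      ∏ ν ∈ Finset.univ.erase b.dir, max 0 (1 - ((rel (emb e.src) b.src ν).natAbs : ℝ) / P.L) else 0)
    (hlift : ∀ (X : GaugeField P (j + 1) SU2) (b : PBond P j), lift j X b = expPoint (∑ e, wt j b e • ((P.L : ℝ)⁻¹ • logVec (su2Quat (X e)))))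
    (hT4 : ∀ x, axialT (GaugeField.gaugeAct (g j) (Averaging.iter (fun i => blockAvg (P := P) (j := i) ℰp) j U)) (emb (blockOf x)) x =
      axialT (lift j (GaugeField.gaugeAct (g (j + 1)) (Averaging.iter (fun i => blockAvg (P := P) (j := i) ℰp) (j + 1) U))) (emb (blockOf x)) x)
    (hT4' : ∀ x, axialT (GaugeField.gaugeAct (g₀ j) (Averaging.iter (fun i => blockAvg (P := P) (j := i) ℰp) j U₁)) (emb (blockOf x)) x =
      axialT (lift j (GaugeField.gaugeAct (g₀ (j + 1)) (Averaging.iter (fun i => blockAvg (P := P) (j := i) ℰp) (j + 1) U₁))) (emb (blockOf x)) x)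
    (hT5 : (blockAvg (P := P) (j := j) ℰp).avg (GaugeField.gaugeAct (g j) (Averaging.iter (fun i => blockAvg (P := P) (j := i) ℰp) j U)) =
      GaugeField.gaugeAct (g (j + 1)) (Averaging.iter (fun i => blockAvg (P := P) (j := i) ℰp) (j + 1) U))
    (hT5' : (blockAvg (P := P) (j := j) ℰp).avg (GaugeField.gaugeAct (g₀ j) (Averaging.iter (fun i => blockAvg (P := P) (j := i) ℰp) j U₁)) =
      GaugeField.gaugeAct (g₀ (j + 1)) (Averaging.iter (fun i => blockAvg (P := P) (j := i) ℰp) (j + 1) U₁))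
    (hcomm : ∀ x y : SU2, dist1 (x * y * x⁻¹ * y⁻¹) ≤ 2 * dist1 x * dist1 y)
    (pS : PBond P j → Prop) {ρκ a σ m : ℝ} (ha : 0 ≤ a) (hm0 : 0 ≤ m) (hL2 : 2 ≤ P.L) (hσ4 : σ ≤ 1 / 4)
    (hκrel : ∀ b : PBond P j, pS b → blockOf (b.src.shift b.dir) ≠ blockOf b.src →
      dist1 (corr ℰp (GaugeField.gaugeAct (g j) (Averaging.iter (fun i => blockAvg (P := P) (j := i) ℰp) j U)) ⟨blockOf b.src, b.dir⟩ *
        (corr ℰp (GaugeField.gaugeAct (g₀ j) (Averaging.iter (fun i => blockAvg (P := P) (j := i) ℰp) j U₁)) ⟨blockOf b.src, b.dir⟩)⁻¹) ≤ ρκ)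
    (hplaq : PlaqSmall a (GaugeField.gaugeAct (g₀ j) (Averaging.iter (fun i => blockAvg (P := P) (j := i) ℰp) j U₁)))
    (hthr : ((((P.d + 2) * P.L : ℕ) : ℝ) ^ 2 / 4) * a < deltaSU (Fin 2))
    (hσS : ∀ b : PBond P j, pS b → blockOf (b.src.shift b.dir) ≠ blockOf b.src →
      ‖logVec (su2Quat (GaugeField.gaugeAct (g (j + 1)) (Averaging.iter (fun i => blockAvg (P := P) (j := i) ℰp) (j + 1) U) ⟨blockOf b.src, b.dir⟩))‖ ≤ σ)
    (hσS' : ∀ b : PBond P j, pS b → blockOf (b.src.shift b.dir) ≠ blockOf b.src →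
      ‖logVec (su2Quat (GaugeField.gaugeAct (g₀ (j + 1)) (Averaging.iter (fun i => blockAvg (P := P) (j := i) ℰp) (j + 1) U₁) ⟨blockOf b.src, b.dir⟩))‖ ≤ σ)
    (hmS : ∀ b : PBond P j, pS b → blockOf (b.src.shift b.dir) ≠ blockOf b.src →
      ‖logVec (su2Quat (GaugeField.gaugeAct (g (j + 1)) (Averaging.iter (fun i => blockAvg (P := P) (j := i) ℰp) (j + 1) U) ⟨blockOf b.src, b.dir⟩ *
        (GaugeField.gaugeAct (g₀ (j + 1)) (Averaging.iter (fun i => blockAvg (P := P) (j := i) ℰp) (j + 1) U₁) ⟨blockOf b.src, b.dir⟩)⁻¹))‖ ≤ m) :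
    ∀ b : PBond P j, pS b → blockOf (b.src.shift b.dir) ≠ blockOf b.src →
      dist1 ((lift j (GaugeField.gaugeAct (g (j + 1)) (Averaging.iter (fun i => blockAvg (P := P) (j := i) ℰp) (j + 1) U))
              ⟨transl (emb (blockOf b.src)) (fun ν => if ν = b.dir then (((P.L - 1) / 2 : ℕ) : ℤ) else 0), b.dir⟩ *
            (lift j (GaugeField.gaugeAct (g₀ (j + 1)) (Averaging.iter (fun i => blockAvg (P := P) (j := i) ℰp) (j + 1) U₁))
              ⟨transl (emb (blockOf b.src)) (fun ν => if ν = b.dir then (((P.L - 1) / 2 : ℕ) : ℤ) else 0), b.dir⟩)⁻¹)⁻¹ *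
        (GaugeField.gaugeAct (g j) (Averaging.iter (fun i => blockAvg (P := P) (j := i) ℰp) j U)
            ⟨transl (emb (blockOf b.src)) (fun ν => if ν = b.dir then (((P.L - 1) / 2 : ℕ) : ℤ) else 0), b.dir⟩ *
          (GaugeField.gaugeAct (g₀ j) (Averaging.iter (fun i => blockAvg (P := P) (j := i) ℰp) j U₁)
            ⟨transl (emb (blockOf b.src)) (fun ν => if ν = b.dir then (((P.L - 1) / 2 : ℕ) : ℤ) else 0), b.dir⟩)⁻¹)) ≤
        ρκ + 2 * (6 * (((((P.d + 2) * P.L : ℕ) : ℝ) ^ 2 / 4) * a)) * ((((P.L - 1) / 2 + 1 : ℕ) : ℝ) * (11 / 10 * ((P.L : ℝ)⁻¹ * m))) := by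
  have hmR : 0 ≤ 11 / 10 * ((P.L : ℝ)⁻¹ * m) := by positivity
  refine central_hC_of_letters ℰp hj wt lift g g₀ U U₁ hwt hlift hT4 hT4' hT5 hT5' hcomm pS hmR hκrel (fun b hb hx => dist1_corr_le ha hplaq hthr _) ?_
  intro b hb hx
  rw [centralBond_eq_b0]
  refine (dist1_le_norm_logVec _).trans ?_
  exact norm_logVec_liftChord_le_eleven_tenths hj (wt j) hwt _ _ _ _
    (fun b' => hlift (GaugeField.gaugeAct (g (j + 1)) (Averaging.iter (fun i => blockAvg (P := P) (j := i) ℰp) (j + 1) U)) b')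
    (fun b' => hlift (GaugeField.gaugeAct (g₀ (j + 1)) (Averaging.iter (fun i => blockAvg (P := P) (j := i) ℰp) (j + 1) U₁)) b')
    (b0 ⟨blockOf b.src, b.dir⟩) hL2 hσ4
    (feeder_b0 hj (wt j) hwt ⟨blockOf b.src, b.dir⟩ (hQ := hσS b hb hx))
    (feeder_b0 hj (wt j) hwt ⟨blockOf b.src, b.dir⟩ (hQ := hσS' b hb hx))
    (feeder_b0 hj (wt j) hwt ⟨blockOf b.src, b.dir⟩ (hQ := hmS b hb hx))

end Summit.QuantumFields.YangMills.Theorems.FluctuationComparisonRegPrIntLS2BetaCentralFaceLetters
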